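import Literature.AlgebraicGeometry.HodgeTheory.VHSDataHodgeGenericPointsDescent
import Mathlib.Topology.Separation.GDelta
import HarnessLib

/-!
# Hodge-generic points form a RESIDUAL (comeagre) `G_δ`-set; the non-generic points and every exceptional Hodge locus are MEAGRE — Deligne's
# «complement of a meagre subset» (La conjecture de Weil pour les surfaces K3, Prop. 7.5; André 1992, Lemma 4) for locally flat-charted VHS data over a
# one-dimensional base

Topic `Literature/AlgebraicGeometry/HodgeTheory` (namespaces `Literature.AlgebraicGeometry.HodgeTheory` for the topology, `Literature.AlgebraicGeometry.Motives.VHSData`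
for the VHS statements), lane `lit-hodgefound` (seat `p08`, row g61-#20); built on `VHSDataHodgeGenericPoints` (`hodgeGenericLocus`, `dense_of_countable_compl`,
`IsLocallyFlatCharted.countable_compl_hodgeGenericLocus[_of_compactification]`), `VHSDataHodgeClassesAlongPaths` (`IsLocallyFlatCharted.countable_exceptionalHodgeLocus`),
`VHSDataHodgeGenericPointsDescent` (covering descent) and Mathlib's Baire vocabulary (`residual`, `IsMeagre`, `IsGδ`, `Set.Countable.isGδ_compl`,
`residual_of_dense_Gδ`).  THEOREMS ONLY — no definition, no named fact, no instance (D-0026 net debt `0`).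

PRINTED SOURCES, VERBATIM.  Y. André, *Mumford–Tate groups of mixed Hodge structures and the theorem of the fixed part*, Compositio Math. 82 (1992), §4 Lemma 4
(p. 7): «On the (pathwise connected) complement `X̊` of some meager subset of `X`, `G_x` is locally constant» (after P. Deligne, *La conjecture de Weil pour les
surfaces K3*, Invent. Math. 15 (1972), Prop. 7.5: outside a countable union of proper analytic subvarieties — a meagre set — the Mumford–Tate group is the
generic one); M. Green, P. Griffiths, M. Kerr (2012), Ch. III (III.2) (the Hodge-generic points are the complement of countably many proper analytic
subvarieties); C. Voisin, *Hodge Theory II*, §3.3.2 (remark after Thm. 3.32: «a countable union of proper analytic subsets … its complement is dense»).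

CONTENT.
* §1 TOPOLOGY OF A BASE COVERED BY CHARTS INTO `ℂ`: **`t1Space_of_charts`** (such a base is `T₁`), **`mem_residual_of_countable_compl`** (a set with countable
  complement is RESIDUAL: a dense `G_δ`), `isGδ_of_countable_compl`, **`isMeagre_of_countable`** (countable sets are meagre).
* §2 **`IsLocallyFlatCharted.hodgeGenericLocus_mem_residual`** ∕ `isGδ_hodgeGenericLocus` ∕ **`isMeagre_compl_hodgeGenericLocus`** (Lindelöf base, flat interior
  charts: THE HODGE-GENERIC POINTS ARE THE COMPLEMENT OF A MEAGRE SET), **`isMeagre_exceptionalHodgeLocus`** ∕ `compl_exceptionalHodgeLocus_mem_residual` (every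
  exceptional Hodge locus is meagre), and the versions over a punctured compact curve (`…_of_compactification`, no Lindelöf hypothesis).
* §3 COVERINGS: `hodgeGenericLocus_mem_residual_of_comap` (a `T₁` base whose VHS data become flat-charted on a Lindelöf covering space).

HONEST SCOPE.  One-dimensional charted bases (the tree's chart vocabulary); in higher dimension the non-generic locus is a countable union of proper analytic
subvarieties (not here).  No Baire-category THEOREM is invoked: residuality is proved from countability of the complement (stronger than meagreness).

## References

* [Andre1992] Y. André, *Mumford–Tate groups of mixed Hodge structures and the theorem of the fixed part*, Compositio Math. 82 (1992) 1–24, §4 Lemma 4.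
* [Deligne1972WeilK3] P. Deligne, *La conjecture de Weil pour les surfaces K3*, Invent. Math. 15 (1972) 206–226, Prop. 7.5.
* [GreenGriffithsKerr2012] M. Green, P. Griffiths, M. Kerr, *Mumford–Tate Groups and Domains*, Ann. of Math. Studies 183 (2012), Ch. III, (III.2).
* [VoisinHodgeII2003] C. Voisin, *Hodge Theory and Complex Algebraic Geometry II*, CUP (2003), §3.3.2 (remark after Thm. 3.32), §5.3.3.
* [CattaniDeligneKaplan1995] E. Cattani, P. Deligne, A. Kaplan, *On the locus of Hodge classes*, J. Amer. Math. Soc. 8 (1995), Cor. 1.2 (p. 484).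
-/

noncomputable section

open _root_.Topology _root_.Filter Set

namespace Literature.AlgebraicGeometry

open Motives Motives.HodgeStructure HodgeTheory Topology

/-! ## §1 Topology of a base covered by charts into `ℂ` -/

namespace HodgeTheory

variable {S : Type*} [TopologicalSpace S]

/-- **A base covered by charts into `ℂ` is `T₁`** (separate inside a chart domain by the Hausdorff target, outside by the open domain itself).
[cite: VoisinHodgeII2003, §3.3.2] -/
theorem t1Space_of_charts {α : Type*} (ψ : α → OpenPartialHomeomorph S ℂ) (hcov : ∀ x : S, ∃ a, x ∈ (ψ a).source) : T1Space S := by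
  rw [t1Space_iff_exists_open]
  intro x y hxy
  obtain ⟨a, hxa⟩ := hcov x
  by_cases hya : y ∈ (ψ a).source
  · refine ⟨(ψ a).source ∩ ψ a ⁻¹' {ψ a y}ᶜ, (ψ a).isOpen_inter_preimage isOpen_compl_singleton, ⟨hxa, ?_⟩, fun h => h.2 rfl⟩
    exact fun h => hxy ((ψ a).injOn hxa hya h)
  · exact ⟨(ψ a).source, (ψ a).open_source, hxa, hya⟩

/-- **On a base covered by charts into `ℂ`, a set with countable complement is a `G_δ`.** [cite: VoisinHodgeII2003, §3.3.2 (remark after Thm. 3.32)] -/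
theorem isGδ_of_countable_compl {α : Type*} (ψ : α → OpenPartialHomeomorph S ℂ) (hcov : ∀ x : S, ∃ a, x ∈ (ψ a).source) {Z : Set S}
    (hZ : Zᶜ.Countable) : IsGδ Z := by
  haveI := t1Space_of_charts ψ hcov
  simpa only [compl_compl] using hZ.isGδ_compl

/-- **On a base covered by charts into `ℂ`, a set with countable complement is RESIDUAL** (a dense `G_δ`: «complement of a meagre subset»).
[cite: Andre1992, §4 Lemma 4] [cite: VoisinHodgeII2003, §3.3.2 (remark after Thm. 3.32)] -/
theorem mem_residual_of_countable_compl {α : Type*} (ψ : α → OpenPartialHomeomorph S ℂ) (hcov : ∀ x : S, ∃ a, x ∈ (ψ a).source) {Z : Set S}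
    (hZ : Zᶜ.Countable) : Z ∈ residual S :=
  residual_of_dense_Gδ (isGδ_of_countable_compl ψ hcov hZ) (dense_of_countable_compl ψ hcov hZ)

/-- **On a base covered by charts into `ℂ`, countable sets are MEAGRE.** [cite: Andre1992, §4 Lemma 4] [cite: Deligne1972WeilK3, Prop. 7.5] -/
theorem isMeagre_of_countable {α : Type*} (ψ : α → OpenPartialHomeomorph S ℂ) (hcov : ∀ x : S, ∃ a, x ∈ (ψ a).source) {Z : Set S} (hZ : Z.Countable) :
    IsMeagre Z := by
  rw [IsMeagre]
  exact mem_residual_of_countable_compl ψ hcov (by rwa [compl_compl])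

end HodgeTheory

/-! ## §2 Hodge-generic points are residual; exceptional loci are meagre -/

namespace Motives.VHSData

variable {S : Type} [TopologicalSpace S] {k : ℤ} {D : VHSData S k}

namespace IsLocallyFlatCharted

variable {α ι : Type*} {ψ : α → OpenPartialHomeomorph S ℂ} {σ : ι → ℂ → S}

/-- **EVERY EXCEPTIONAL HODGE LOCUS IS MEAGRE** (Lindelöf base, flat interior charts covering it). [cite: Deligne1972WeilK3, Prop. 7.5]
[cite: CattaniDeligneKaplan1995, Cor. 1.2 (p. 484)] [cite: VoisinHodgeII2003, §3.3.2] -/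
theorem isMeagre_exceptionalHodgeLocus [LindelofSpace S] (h : D.IsLocallyFlatCharted ψ σ) (hcov : ∀ x : S, ∃ a, x ∈ (ψ a).source) (p : ℤ) :
    IsMeagre (D.exceptionalHodgeLocus p) :=
  isMeagre_of_countable ψ hcov (h.countable_exceptionalHodgeLocus hcov p)

/-- The complement of an exceptional Hodge locus is residual. [cite: Deligne1972WeilK3, Prop. 7.5] [cite: VoisinHodgeII2003, §3.3.2] -/
theorem compl_exceptionalHodgeLocus_mem_residual [LindelofSpace S] (h : D.IsLocallyFlatCharted ψ σ) (hcov : ∀ x : S, ∃ a, x ∈ (ψ a).source) (p : ℤ) :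
    (D.exceptionalHodgeLocus p)ᶜ ∈ residual S :=
  mem_residual_of_countable_compl ψ hcov (by rw [compl_compl]; exact h.countable_exceptionalHodgeLocus hcov p)

/-- **THE HODGE-GENERIC POINTS FORM A RESIDUAL SET** («on the complement of some meager subset … `G_x` is locally constant»; Lindelöf one-dimensional base,
flat interior charts). [cite: Andre1992, §4 Lemma 4] [cite: Deligne1972WeilK3, Prop. 7.5] [cite: GreenGriffithsKerr2012, Ch. III (III.2)] -/
theorem hodgeGenericLocus_mem_residual [LindelofSpace S] (h : D.IsLocallyFlatCharted ψ σ) (hcov : ∀ x : S, ∃ a, x ∈ (ψ a).source) :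
    D.hodgeGenericLocus ∈ residual S :=
  mem_residual_of_countable_compl ψ hcov (h.countable_compl_hodgeGenericLocus hcov)

/-- The Hodge-generic locus is a `G_δ`. [cite: GreenGriffithsKerr2012, Ch. III (III.2)] [cite: Deligne1972WeilK3, Prop. 7.5] -/
theorem isGδ_hodgeGenericLocus [LindelofSpace S] (h : D.IsLocallyFlatCharted ψ σ) (hcov : ∀ x : S, ∃ a, x ∈ (ψ a).source) : IsGδ D.hodgeGenericLocus :=
  isGδ_of_countable_compl ψ hcov (h.countable_compl_hodgeGenericLocus hcov)

/-- **THE NON-GENERIC POINTS FORM A MEAGRE SET.** [cite: Andre1992, §4 Lemma 4] [cite: Deligne1972WeilK3, Prop. 7.5] -/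
theorem isMeagre_compl_hodgeGenericLocus [LindelofSpace S] (h : D.IsLocallyFlatCharted ψ σ) (hcov : ∀ x : S, ∃ a, x ∈ (ψ a).source) :
    IsMeagre (D.hodgeGenericLocus)ᶜ :=
  isMeagre_of_countable ψ hcov (h.countable_compl_hodgeGenericLocus hcov)

variable {X : Type*} [TopologicalSpace X] [CompactSpace X]

/-- **Over a punctured compact curve** (no Lindelöf hypothesis): the Hodge-generic points form a residual set and the non-generic points a meagre set.
[cite: Andre1992, §4 Lemma 4] [cite: Deligne1972WeilK3, Prop. 7.5] [cite: CattaniDeligneKaplan1995, Cor. 1.2 (p. 484), 2.3 (p. 487)] -/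
theorem hodgeGenericLocus_mem_residual_of_compactification (h : D.IsLocallyFlatCharted ψ σ) (hcov : ∀ x : S, ∃ a, x ∈ (ψ a).source)
    (A : ι → ℝ) {j : S → X} (hj : IsEmbedding j) (pt : ι → X) (hpS : ∀ i, pt i ∉ range j) (hcovX : ∀ x : X, x ∉ range j → ∃ i, x = pt i)
    (φ : ι → OpenPartialHomeomorph X ℂ) (hp : ∀ i, pt i ∈ (φ i).source) (hφp : ∀ i, φ i (pt i) = 0)
    (hball : ∀ i, Metric.ball (0 : ℂ) (Real.exp (-(2 * Real.pi * A i))) ⊆ (φ i).target)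
    (hσ : ∀ (i : ι) (z : ℂ), A i < z.im → j (σ i z) = (φ i).symm (Complex.exp (2 * Real.pi * Complex.I * z))) :
    D.hodgeGenericLocus ∈ residual S ∧ IsMeagre (D.hodgeGenericLocus)ᶜ :=
  ⟨mem_residual_of_countable_compl ψ hcov (h.countable_compl_hodgeGenericLocus_of_compactification hcov A hj pt hpS hcovX φ hp hφp hball hσ),
    isMeagre_of_countable ψ hcov (h.countable_compl_hodgeGenericLocus_of_compactification hcov A hj pt hpS hcovX φ hp hφp hball hσ)⟩

end IsLocallyFlatCharted

/-! ## §3 Through a covering -/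

/-- **Through a covering**: on a `T₁` base `S` whose non-generic locus is countable and whose Hodge-generic locus is dense (e.g. by descent from a flat-charted
Lindelöf covering space, `IsLocallyFlatCharted.countable_compl_and_dense_hodgeGenericLocus_of_comap`), the Hodge-generic points form a residual `G_δ` and
the non-generic points a meagre set. [cite: Andre1992, §4 Lemma 4] [cite: Deligne1972WeilK3, Prop. 7.5] -/
theorem hodgeGenericLocus_mem_residual_of_countable_of_dense [T1Space S] (D : VHSData S k) (hc : (D.hodgeGenericLocus)ᶜ.Countable)
    (hd : Dense D.hodgeGenericLocus) : D.hodgeGenericLocus ∈ residual S ∧ IsMeagre (D.hodgeGenericLocus)ᶜ := by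
  have hG : IsGδ D.hodgeGenericLocus := by simpa only [compl_compl] using hc.isGδ_compl
  refine ⟨residual_of_dense_Gδ hG hd, ?_⟩
  rw [IsMeagre, compl_compl]
  exact residual_of_dense_Gδ hG hd

/-- The covering form: `f : S' → S` a surjective covering map from a Lindelöf space on which `D.comap f` is flat-charted, `S` a `T₁` space.
[cite: Andre1992, §4 Lemma 4] [cite: GreenGriffithsKerr2012, Ch. III (III.2)] -/
theorem hodgeGenericLocus_mem_residual_of_comap [T1Space S] {S' : Type} [TopologicalSpace S'] [LindelofSpace S'] {f : C(S', S)}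
    (hf : IsCoveringMap f) (hsurj : Function.Surjective f) {α ι : Type*} {ψ : α → OpenPartialHomeomorph S' ℂ} {σ : ι → ℂ → S'}
    (h : (D.comap f).IsLocallyFlatCharted ψ σ) (hcov : ∀ x : S', ∃ a, x ∈ (ψ a).source) :
    D.hodgeGenericLocus ∈ residual S ∧ IsMeagre (D.hodgeGenericLocus)ᶜ := by
  obtain ⟨hc, hd⟩ := IsLocallyFlatCharted.countable_compl_and_dense_hodgeGenericLocus_of_comap hf hsurj h hcov
  exact D.hodgeGenericLocus_mem_residual_of_countable_of_dense hc hd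

end Motives.VHSData

end Literature.AlgebraicGeometry

end
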